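import Literature.NumberTheory.GaloisRepresentations.ContinuousShapiroOpenCoinducedLayerShapiro
import HarnessLib

/-!
# The Shapiro isomorphism of the permutation model READ AT THE `Ext` LEVEL of door-c4's comparison:
# `sh (Φ_Γ e) = Φ_W (ev₁ ∘ Res_W e)` (Serre, *Cohomologie galoisienne* I §2.5 Prop. 10; Harari §4.3)

Topic `NumberTheory/GaloisRepresentations` (continuous cochain cohomology); namespace
`Literature.NumberTheory.GaloisRepresentations` (dot notation under `ContinuousRep`).  THEOREMS ONLY (no
definition, no named fact, no `sorry`, no instance).  Sequel of `ContinuousShapiroOpenCoinducedLayerShapiro`.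

For `Γ` profinite, `W ⊴ Γ` open (compact, of finite index), `M` a discrete `Γ`-module and
`C = Maps(Γ ⧸ W, M)`: the tree's Shapiro isomorphism `sh = ρ.shapiroOpenAddEquiv W hW n :
Hⁿ_cont(Γ, C) ≃+ Hⁿ_cont(W, M|_W)` is, through door-c4's comparison `Φ = extTrivAddEquivContinuousCohomology`
(`Extⁿ_{C_Γ}(k, ·) ≃+ Hⁿ_cont`), the `Ext`-level map "restrict to `W` (`extRes W`), then push along
`ev₁ : C|_W → M|_W`":

  `sh (Φ_Γ e) = Φ_W ((extRes W e) ∘ [ev₁])`       (`shapiroOpenAddEquiv_extTriv`),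

assembled from the tree's `extTrivAddEquivContinuousCohomology_res` (the comparison commutes with
restriction to an open subgroup), `extTrivAddEquivContinuousCohomology_naturality` (… with module maps),
`continuousCohomologyAddEquiv_map` (naturality of the scalar-free transport) and
`continuousCohomologyAddEquiv_refl` (§1: the transport along the identity is the identity).  With
`extRes_inflG_shapiroFun` and `coindOpenHRep_layer_conj` this gives, for the lane «TATE-EPC-TC» of cell
`bsd-eis` (crux `GoodLatticeBDPValue`, stmt-BirchSwinnertonDyer-19032; piece (θ-i)-top), the full
statement: `sh` of the class with `Γ`-layer representative `y` is `Φ_W` of the class with `W`-layer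
representative `Hⁿ(κ, λ)(shapiroFun y)`, on which `Δ` acts by `conjRepCohomology`
(`shapiroOpenAddEquiv_extTriv_inflG`).  HONEST FRAMING: homological algebra only.

## References
* J.-P. Serre, *Cohomologie galoisienne* (1994), I §2.2 Prop. 8, §2.5 Prop. 10. [SerreGaloisCohomology1997]
* D. Harari, *Galois Cohomology and Class Field Theory* (2020), §4.3, Remark 4.24. [Harari2020]
* J. Neukirch, A. Schmidt, K. Wingberg, *Cohomology of Number Fields*, 2nd ed. (2008), I §6 (1.6.4).
  [NeukirchSchmidtWingberg2008]
-/

noncomputable section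

namespace Literature.NumberTheory.GaloisRepresentations

open CategoryTheory CategoryTheory.Limits CategoryTheory.Abelian Literature.Algebra.Homology
  Literature.Algebra.Homology.DiscreteRep Literature.Algebra.Homology.DiscreteRep.LayerColimit
  Literature.Algebra.Homology.PermutationDual Literature.Algebra.Homology.QuotientMaps
open _root_.TopRep _root_.ContRepresentation _root_.ContinuousCohomology

/-! ### §1. The scalar-free transport along the identity is the identity -/

section Refl

universe v
variable {k : Type v} [Ring k] [TopologicalSpace k] {G : Type v} [Group G] [TopologicalSpace G]
  [IsTopologicalGroup G] {X : TopRep.{v} k G}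

/-- `resolutionEquiv (refl) m = id`. [cite: SerreGaloisCohomology1997, I §2.2] -/
private theorem resolutionEquiv_refl_apply :
    ∀ (m : ℕ) (f : (resolutionX X m : Type v)),
      resolutionEquiv (ContinuousAddEquiv.refl (X : Type v)) m f = f
  | 0, _ => rfl
  | m + 1, f => ContinuousMap.ext fun x => by
      rw [resolutionEquiv_succ_apply]
      exact resolutionEquiv_refl_apply m (f x)

/-- **The transport `continuousCohomologyAddEquiv` along the identity is the identity.**
[cite: SerreGaloisCohomology1997, I §2.2] -/
theorem continuousCohomologyAddEquiv_refl (n : ℕ) (x : continuousCohomology n X) :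
    continuousCohomologyAddEquiv (X := X) (Y := X) (ContinuousAddEquiv.refl (X : Type v))
      (fun _ _ => rfl) n x = x := by
  obtain ⟨c, hc, rfl⟩ := cxClass_surjective (homogeneousCochains X) n (n + 1) (up_nat_next n) x
  rw [continuousCohomologyAddEquiv_cxClass]
  exact cxClass_congr (Subtype.ext (resolutionEquiv_refl_apply (n + 1) c.1))

end Refl

/-! ### §2. `sh (Φ_Γ e) = Φ_W (ev₁ ∘ Res_W e)` -/

namespace ContinuousRep

variable {G : Type} [Group G] [TopologicalSpace G] [IsTopologicalGroup G] [CompactSpace G]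
  [T2Space G] [TotallyDisconnectedSpace G]
variable {M : Type} [AddCommGroup M] [TopologicalSpace M] [DiscreteTopology M]
variable (ρ : ContinuousRep G ℤ M) (W : Subgroup G) [W.Normal] (hW : IsOpen (W : Set G))
variable (hD : DiscreteTopology (ρ.coindOpen W hW).toTopRep.V) [CompactSpace W] [W.FiniteIndex]
  [PreservesFiniteLimits (resD ℤ W)] [PreservesFiniteColimits (resD ℤ W)]

omit [CompactSpace W] [W.FiniteIndex] [PreservesFiniteLimits (resD ℤ W)] [PreservesFiniteColimits (resD ℤ W)] in
/-- **The Shapiro isomorphism of the permutation model is `Hⁿ(W ↪ Γ, ev₁)`**: restriction to `W`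
followed by evaluation at `1` (through the identification `Maps(Γ⧸W, M) ≃ M_Γ^W(M|_W)` of
`coindOpenEquiv`, under which `a* ↦ a*(1)` is `φ ↦ φ(1)`). [cite: SerreGaloisCohomology1997, I §2.5 Prop. 10] -/
theorem shapiroOpenAddEquiv_eq_map (n : ℕ) (x : continuousCohomology n (ρ.coindOpen W hW).toTopRep) :
    ρ.shapiroOpenAddEquiv W hW n x =
      (ContinuousCohomology.map (subgroupIncl W) (ρ.coindOpenEvalOne W hW) n).hom x := by
  haveI : IsClosed (W : Set G) := Subgroup.isClosed_of_isOpen W hW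
  unfold shapiroOpenAddEquiv
  rw [AddEquiv.trans_apply, shapiroAddEquiv_apply]
  have h := continuousCohomologyAddEquiv_map
    (X := (ρ.coindOpen W hW).toTopRep) (X' := (coindRep (ρ.restrict (subgroupIncl W))).toTopRep)
    (Y := (ρ.restrict (subgroupIncl W)).toTopRep) (Y' := (ρ.restrict (subgroupIncl W)).toTopRep)
    (ρ.coindOpenEquiv W hW : (G ⧸ W → M) ≃ₜ+ _) (fun g φ => ρ.coindOpenEquiv_map W hW g φ)
    (ContinuousAddEquiv.refl _) (fun _ _ => rfl)
    (subgroupIncl W) (ρ.coindOpenEvalOne W hW) (coindEvalOne (ρ.restrict (subgroupIncl W)))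
    (fun φ => by
      change φ (1 : G ⧸ W) = ρ 1 (φ (((1 : G)⁻¹ : G) : G ⧸ W))
      rw [map_one, Module.End.one_apply, inv_one]; rfl) n x
  rw [continuousCohomologyAddEquiv_refl] at h
  exact h.symm

/-- **`sh (Φ_Γ e) = Φ_W (ev₁_* (Res_W e))`**: the Shapiro isomorphism read at the `Ext` level of
door-c4's comparison (`extRes W` = restriction along the exact functor `resD`, `ev₁_*` = Yoneda
composition with `[ev₁]`). [cite: SerreGaloisCohomology1997, I §2.5 Prop. 10] [cite: Harari2020, §4.3 (2), Remark 4.24] -/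
theorem shapiroOpenAddEquiv_extTriv (n : ℕ)
    (e : Ext (triv (Γ := G) ℤ) (stdBase (ρ.coindOpen W hW).toTopRep (ρ.isDiscrete_coindOpen W hW)) n) :
    ρ.shapiroOpenAddEquiv W hW n
        (extTrivAddEquivContinuousCohomology (ρ.coindOpen W hW).toTopRep (ρ.isDiscrete_coindOpen W hW) n e) =
      extTrivAddEquivContinuousCohomology (resTop W ρ.toTopRep) (isDiscrete_resTop W ρ.isDiscrete_self) n
        ((extRes W (triv (Γ := G) ℤ) _ n e).comp
          (Ext.mk₀ (stdBaseMap (isDiscrete_resTop W (ρ.isDiscrete_coindOpen W hW))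
            (isDiscrete_resTop W ρ.isDiscrete_self) (ρ.coindOpenEvalOne W hW))) (add_zero n)) := by
  rw [shapiroOpenAddEquiv_eq_map]
  -- `Hⁿ(W ↪ Γ, ev₁) = Hⁿ(id_W, ev₁) ∘ Hⁿ(W ↪ Γ, 𝟙)`
  rw [map_comp_apply_of (inclT W) (ContinuousMonoidHom.id W) (subgroupIncl W) (fun _ => rfl)
    (𝟙 (resTop W (ρ.coindOpen W hW).toTopRep)) (resIdHom (ρ.coindOpenEvalOne W hW))
    (ρ.coindOpenEvalOne W hW) (fun _ => rfl) n]
  rw [extTrivAddEquivContinuousCohomology_res W (ρ.isDiscrete_coindOpen W hW) hW n e]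
  exact extTrivAddEquivContinuousCohomology_naturality (isDiscrete_resTop W (ρ.isDiscrete_coindOpen W hW))
    (isDiscrete_resTop W ρ.isDiscrete_self) (ρ.coindOpenEvalOne W hW) n _

/-- **THE SHAPIRO ISOMORPHISM ON LAYER REPRESENTATIVES.**  For `V ⊴ Γ` open with `V ≤ W` and a class `y`
of the `funRep`-layer `Hⁿ(Γ⧸V, Maps((Γ⧸V)⧸(W⧸V), M^V))`:
`sh (Φ_Γ (Inf^Γ_V (iso⁻¹ y))) = Φ_W (Inf^W_{V∩W} (Hⁿ(κ, λ) (shapiroFun y)))` — the continuous Shapiro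
image of the class with `Γ`-layer representative `y` is the class (of `Hⁿ_cont(W, M|_W)`) with `W`-layer
representative the FINITE Shapiro image `shapiroFun y ∈ Hⁿ(W⧸V, M^V)` (-w6 g9), transported along
`κ : W⧸(V∩W) ≃ W⧸V`.  Together with `coindOpenHRep_layer_conj` (the `Δ`-action on `y` is `Hⁿ(rTrans)`,
read by `shapiroFun` as `conjRepCohomology`) and `shapiroOpenAddEquiv_coindOpenHRep_two` (`sh` carries the
`Δ`-action to `conjMap`), this is the layer dictionary of the right-action `Δ`-module
`Hⁿ_cont(Γ, Maps(Δ, M)) ≅ Hⁿ_cont(W, M)`. [cite: SerreGaloisCohomology1997, I §2.2 Prop. 8, §2.5 Prop. 10]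
[cite: NeukirchSchmidtWingberg2008, I §6 (1.6.4)–(1.6.5)] -/
theorem shapiroOpenAddEquiv_extTriv_inflG (V : OpenNormalSubgroup G) (hVW : (V : Subgroup G) ≤ W) (n : ℕ)
    (y : groupCohomology (funRep ((invariantsQuotFunctor ℤ (V : Subgroup G)).obj
      (stdBase ρ.toTopRep ρ.isDiscrete_self))
        ((G ⧸ (V : Subgroup G)) ⧸ W.map (QuotientGroup.mk' (V : Subgroup G)))) n) :
    ρ.shapiroOpenAddEquiv W hW n
        (extTrivAddEquivContinuousCohomology (ρ.coindOpen W hW).toTopRep (ρ.isDiscrete_coindOpen W hW) n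
          (inflG V _ n ((groupCohomology.map (MonoidHom.id _) (ρ.coindOpenLayerIso W hW V hVW hD).inv n).hom y))) =
      extTrivAddEquivContinuousCohomology (resTop W ρ.toTopRep) (isDiscrete_resTop W ρ.isDiscrete_self) n
        (inflG (traceOpenNormalSubgroup W V) (stdBase (resTop W ρ.toTopRep) (isDiscrete_resTop W ρ.isDiscrete_self)) n
          ((groupCohomology.map (traceQuotMapRange W V) (ρ.traceLayerHomRange W V) n).hom
            ((QuotientMaps.shapiroFun (W.map (QuotientGroup.mk' (V : Subgroup G))) _ n).hom y))) := by
  rw [shapiroOpenAddEquiv_extTriv, ρ.extRes_inflG_shapiroFun W hW V hVW hD n y]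

end ContinuousRep

end Literature.NumberTheory.GaloisRepresentations

end
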